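import Summits.ValiantsHypothesis.ValiantsHypothesis.Theses.RyserTripartition
import Literature.Computability.AlgebraicComplexity.ValiantConjectureProofs

/-!
# ValiantsHypothesis / RyserTripartition — item `Assembly` (stmt-ValiantsHypothesis-7166), closed

`RyserOptimal → ValiantsHypothesis`: if `VP ℂ = VNP ℂ` then the permanent family is in `VP`
(`perFamily_mem_VNP_holds`, `mem_VP_ofFintype_iff_holds`), so `L(per_n) ≤ n^c + c` for all `n`;
`RyserOptimal` at `ε = 1/2` gives `2^{n/2} ≤ L(per_n)` for `n ≥ n₀`; at `n = 2 · 2^t` with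
`t = c + c² + (c + 1 + n₀)` this reads `2^{2^t} ≤ 2^{(t+1)c} + c < 2^{(t+1)c+1} ≤ 2^{2^t}`
(`c t + c + 1 < 2^t` from `x + 1 ≤ 2^x`). HONEST FRAMING: bookkeeping; `RyserOptimal` (Ryser's
formula is optimal up to `2^{εn}`) is an OPEN crux far beyond the state of the art; nothing here is
progress on `VP ≠ VNP`.
-/

-- layout Summits/ValiantsHypothesis/ValiantsHypothesis forces the duplicated namespace component
set_option linter.dupNamespace false

namespace Summit.ValiantsHypothesis.ValiantsHypothesis.Theorems.RyserTripartition

open Literature.Computability.AlgebraicComplexity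

/-- Exponential beats linear: `K t + B < 2^t` at `t = K + (K² + B)` (from `x + 1 ≤ 2^x`). [folklore] -/
private theorem linear_lt_two_pow' (K B : ℕ) : K * (K + (K * K + B)) + B < 2 ^ (K + (K * K + B)) := by
  have h1 : K + 1 ≤ 2 ^ K := Nat.lt_two_pow_self
  have h2 : K * K + B + 1 ≤ 2 ^ (K * K + B) := Nat.lt_two_pow_self
  have h3 : (K + 1) * (K * K + B + 1) ≤ 2 ^ (K + (K * K + B)) := by
    rw [pow_add]; exact Nat.mul_le_mul h1 h2
  nlinarith

/-- **Item `Assembly` (stmt-ValiantsHypothesis-7166):** `RyserOptimal → ValiantsHypothesis`.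
[folklore] -/
theorem assembly_proof : Theses.RyserTripartition.Assembly := by
  unfold Theses.RyserTripartition.Assembly Theses.RyserTripartition.RyserOptimal
  intro hR
  show VP ℂ ≠ VNP ℂ
  intro hEq
  -- `per ∈ VP`: a polynomial complexity bound
  have hVP : IsVPFamily (fun n => perPoly (Fin n) ℂ) := by
    refine (mem_VP_ofFintype_iff_holds _).1 ?_
    rw [hEq]
    exact perFamily_mem_VNP_holds ℂ
  obtain ⟨c, hc⟩ := hVP.2
  -- Ryser optimality at `ε = 1/2`
  obtain ⟨n₀, hn₀⟩ := hR (1 / 2) (by norm_num)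
  -- the bad size `n = 2 · 2^t`
  set t := c + (c * c + (c + 1 + n₀)) with ht
  have hlt : c * t + (c + 1 + n₀) < 2 ^ t := by
    have := linear_lt_two_pow' c (c + 1 + n₀)
    rwa [← ht] at this
  have htle : t ≤ 2 ^ t := (Nat.lt_two_pow_self).le
  set m := 2 ^ t with hm
  have hmn₀ : n₀ ≤ 2 * m := by omega
  have hlow := hn₀ (2 * m) hmn₀
  have hup : complexity (perPoly (Fin (2 * m)) ℂ) ≤ (2 * m) ^ c + c := hc (2 * m)
  -- `(2m)^c + c < 2^m`
  have hnat : (2 * m) ^ c + c < 2 ^ m := by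
    have h1 : (2 * m) ^ c = 2 ^ ((t + 1) * c) := by
      rw [hm, pow_mul, pow_succ, mul_comm (2 ^ t) 2]
    have h2 : c < 2 ^ ((t + 1) * c) :=
      (Nat.lt_two_pow_self).trans_le (Nat.pow_le_pow_right (by norm_num) (by nlinarith))
    have h3 : (t + 1) * c + 1 ≤ m := by rw [hm]; nlinarith
    calc (2 * m) ^ c + c < 2 ^ ((t + 1) * c) + 2 ^ ((t + 1) * c) := by rw [h1]; omega
      _ = 2 ^ ((t + 1) * c + 1) := by rw [pow_succ]; ring
      _ ≤ 2 ^ m := Nat.pow_le_pow_right (by norm_num) h3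
  -- the real-side contradiction
  have hexp : (2 : ℝ) ^ ((1 - 1 / 2) * ((2 * m : ℕ) : ℝ)) = ((2 ^ m : ℕ) : ℝ) := by
    have : (1 - 1 / 2 : ℝ) * ((2 * m : ℕ) : ℝ) = ((m : ℕ) : ℝ) := by push_cast; ring
    rw [this, Real.rpow_natCast]
    push_cast
    rfl
  have : ((2 ^ m : ℕ) : ℝ) ≤ (((2 * m) ^ c + c : ℕ) : ℝ) := by
    rw [← hexp]
    exact hlow.trans (by exact_mod_cast hup)
  exact absurd (Nat.cast_le.1 this) (not_le.2 hnat)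

end Summit.ValiantsHypothesis.ValiantsHypothesis.Theorems.RyserTripartition
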